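import Literature.Analysis.Fourier.LinearPhaseOscillatoryIntegral
import Mathlib.Analysis.SpecialFunctions.Integrals.Basic

/-!
# K2 lane (route-2 `SawtoothPulseCascade`, crux dir `K1LocalisedCascade`): the LORENTZIAN ENVELOPE calculus of the forced kink-sheet block

Helper file of the K2 lane (ACL item stmt-AnomalousDissipation-19491; S2-cert forced part, A26-4 (a)). By `…KHForcingClosedForm` the single-mode forcing
of the sheet block is a finite sum of terms `e^{iφs} · C/(μ + i(ν₀ + νs))`, `μ = ±2πa ≠ 0`: a pure phase times a LORENTZIAN ENVELOPE
`A(s) = C/(μ + i(ν₀ + νs))` (p4's «`1/√(1+t²)` corner pulse of height `∝ 1/|a|`»). This file is the envelope calculus the oscillatory Duhamel bound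
(ad-lit L2, `Literature.Analysis.Fourier.LinearPhase.norm_integral_exp_mul_le`: `‖∫_a^b e^{ils}A‖ ≤ (‖A a‖ + ‖A b‖ + ∫_a^b ‖A′‖)/|l|`) consumes:
* `hasDerivAt_lorentz`: `A′(s) = −iνC/(μ + i(ν₀+νs))²`; `continuous_lorentz_deriv`;
* `norm_lorentz_le`: `‖A(s)‖ ≤ ‖C‖/|μ|`; `norm_lorentz_deriv_eq`: `‖A′(s)‖ = ‖C‖|ν|/(μ² + (ν₀+νs)²)`;
* `integral_norm_lorentz_deriv_le`: `∫_a^b ‖A′‖ ≤ ‖C‖π/|μ|` (any `a, b`) (the total variation of the pulse is at most `π/|μ|` times its height scale: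
  `∫ |ν| ds/(μ² + (ν₀+νs)²) = |arctan((ν₀+νb)/μ) − arctan((ν₀+νa)/μ)|/|μ| ≤ π/|μ|`);
* `norm_integral_exp_mul_lorentz_le`: **`‖∫_a^b e^{ils} C/(μ + i(ν₀+νs)) ds‖ ≤ ‖C‖(2 + π)/(|μ||l|)`** for `l ≠ 0`, uniformly in `a ≤ b`, `ν₀`, `ν` —
  the detuned response of one forcing term is bounded by (height × (2+π))/(detuning), uniformly in the slot length.
No definitions; no statement about the crux. [folklore] [problem: turb]
-/

-- `Summit.<Summit>.<Problem>`: single-conjunct summit, the duplicate namespace segment is deliberate.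
set_option linter.dupNamespace false

noncomputable section

namespace Summit.AnomalousDissipation.AnomalousDissipation.Theorems.SawtoothPulseCascade.K2PhaseBudget

open Set MeasureTheory intervalIntegral

/-! ## §1 The envelope and its derivative -/

/-- The Lorentzian denominator does not vanish: `μ + i(ν₀ + νs) ≠ 0` for real `μ ≠ 0`. [folklore] -/
theorem lorentz_denom_ne_zero {μ : ℝ} (hμ : μ ≠ 0) (t : ℝ) : (μ : ℂ) + (t : ℂ) * Complex.I ≠ 0 := by
  intro h; have := congrArg Complex.re h; simp at this; exact hμ this

/-- `‖μ + it‖² = μ² + t²`. [folklore] -/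
theorem normSq_lorentz_denom (μ t : ℝ) : Complex.normSq ((μ : ℂ) + (t : ℂ) * Complex.I) = μ ^ 2 + t ^ 2 := by
  rw [Complex.normSq_apply]; simp; ring

/-- `‖μ + it‖ ≥ |μ|`. [folklore] -/
theorem abs_le_norm_lorentz_denom (μ t : ℝ) : |μ| ≤ ‖(μ : ℂ) + (t : ℂ) * Complex.I‖ := by
  rw [Complex.norm_def, normSq_lorentz_denom, ← Real.sqrt_sq_eq_abs]
  exact Real.sqrt_le_sqrt (by nlinarith)

/-- **Derivative of the Lorentzian envelope:** `d/ds [C/(μ + i(ν₀ + νs))] = −iνC/(μ + i(ν₀+νs))²`. [folklore] -/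
theorem hasDerivAt_lorentz (C : ℂ) {μ : ℝ} (hμ : μ ≠ 0) (ν₀ ν s : ℝ) :
    HasDerivAt (fun s : ℝ => C / ((μ : ℂ) + ((ν₀ + ν * s : ℝ) : ℂ) * Complex.I))
      (-(C * ((ν : ℂ) * Complex.I)) / ((μ : ℂ) + ((ν₀ + ν * s : ℝ) : ℂ) * Complex.I) ^ 2) s := by
  have hd : HasDerivAt (fun s : ℝ => (μ : ℂ) + ((ν₀ + ν * s : ℝ) : ℂ) * Complex.I) ((ν : ℂ) * Complex.I) s := by
    have h1 : HasDerivAt (fun s : ℝ => ν₀ + ν * s) ν s := by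
      have := ((hasDerivAt_id s).const_mul ν).const_add ν₀; simpa using this
    exact (h1.ofReal_comp.mul_const Complex.I).const_add (μ : ℂ)
  have h := (hd.inv (lorentz_denom_ne_zero hμ _)).const_mul C
  have hfun : (fun s : ℝ => C / ((μ : ℂ) + ((ν₀ + ν * s : ℝ) : ℂ) * Complex.I)) =
      fun s : ℝ => C * ((μ : ℂ) + ((ν₀ + ν * s : ℝ) : ℂ) * Complex.I)⁻¹ := funext fun s => div_eq_mul_inv _ _
  rw [hfun]
  refine h.congr_deriv ?_
  rw [neg_div, mul_neg, ← mul_div_assoc, neg_div]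

/-- The derivative of the envelope is continuous. [folklore] -/
theorem continuous_lorentz_deriv (C : ℂ) {μ : ℝ} (hμ : μ ≠ 0) (ν₀ ν : ℝ) :
    Continuous (fun s : ℝ => -(C * ((ν : ℂ) * Complex.I)) / ((μ : ℂ) + ((ν₀ + ν * s : ℝ) : ℂ) * Complex.I) ^ 2) := by
  refine continuous_const.div (by fun_prop) (fun s => pow_ne_zero 2 (lorentz_denom_ne_zero hμ _))

/-! ## §2 Sizes -/

/-- **Height of the pulse:** `‖C/(μ + i(ν₀+νs))‖ ≤ ‖C‖/|μ|`. [folklore] -/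
theorem norm_lorentz_le (C : ℂ) {μ : ℝ} (hμ : μ ≠ 0) (ν₀ ν s : ℝ) :
    ‖C / ((μ : ℂ) + ((ν₀ + ν * s : ℝ) : ℂ) * Complex.I)‖ ≤ ‖C‖ / |μ| := by
  rw [norm_div]
  exact div_le_div_of_nonneg_left (norm_nonneg _) (abs_pos.2 hμ) (abs_le_norm_lorentz_denom μ _)

/-- `‖A′(s)‖ = ‖C‖|ν|/(μ² + (ν₀+νs)²)`. [folklore] -/
theorem norm_lorentz_deriv_eq (C : ℂ) (μ ν₀ ν s : ℝ) :
    ‖-(C * ((ν : ℂ) * Complex.I)) / ((μ : ℂ) + ((ν₀ + ν * s : ℝ) : ℂ) * Complex.I) ^ 2‖ = ‖C‖ * |ν| / (μ ^ 2 + (ν₀ + ν * s) ^ 2) := by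
  rw [norm_div, norm_neg, norm_mul, norm_mul, Complex.norm_I, mul_one, Complex.norm_real, Real.norm_eq_abs, norm_pow,
    Complex.sq_norm, normSq_lorentz_denom]

/-! ## §3 Total variation of the pulse: `∫ ‖A′‖ ≤ ‖C‖ π/|μ|` -/

/-- The arctangent primitive: `d/ds arctan((ν₀ + νs)/μ) = νμ/(μ² + (ν₀+νs)²)` (`μ ≠ 0`). [folklore] -/
theorem hasDerivAt_arctan_affine {μ : ℝ} (hμ : μ ≠ 0) (ν₀ ν s : ℝ) :
    HasDerivAt (fun s : ℝ => Real.arctan ((ν₀ + ν * s) / μ)) (ν * μ / (μ ^ 2 + (ν₀ + ν * s) ^ 2)) s := by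
  have h1 : HasDerivAt (fun s : ℝ => (ν₀ + ν * s) / μ) (ν / μ) s := by
    simpa using (((hasDerivAt_id s).const_mul ν).const_add ν₀).div_const μ
  have h2 := h1.arctan
  refine h2.congr_deriv ?_
  have hμ2 : μ ^ 2 + (ν₀ + ν * s) ^ 2 ≠ 0 := by positivity
  field_simp

/-- **Total variation bound:** `∫_a^b ‖A′(s)‖ ds ≤ ‖C‖·π/|μ|` (any `a, b`) (`A(s) = C/(μ + i(ν₀+νs))`, `μ ≠ 0`): the integrand is
`(‖C‖/|μ|)·|d/ds arctan((ν₀+νs)/μ)|` with a sign-definite derivative, and `arctan` ranges in `(−π/2, π/2)`. [folklore] -/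
theorem integral_norm_lorentz_deriv_le (C : ℂ) {μ : ℝ} (hμ : μ ≠ 0) (ν₀ ν a b : ℝ) :
    ∫ s in a..b, ‖-(C * ((ν : ℂ) * Complex.I)) / ((μ : ℂ) + ((ν₀ + ν * s : ℝ) : ℂ) * Complex.I) ^ 2‖ ≤ ‖C‖ * Real.pi / |μ| := by
  simp_rw [norm_lorentz_deriv_eq]
  -- `∫ ‖C‖|ν|/(μ²+(ν₀+νs)²) = (‖C‖ |ν|/(νμ)) · (g b − g a)` when `ν ≠ 0`; trivial when `ν = 0`
  rcases eq_or_ne ν 0 with hν | hν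
  · subst hν
    simp only [abs_zero, mul_zero, zero_div, intervalIntegral.integral_zero]
    positivity
  set g : ℝ → ℝ := fun s => Real.arctan ((ν₀ + ν * s) / μ) with hg
  have hg' : ∀ s, HasDerivAt g (ν * μ / (μ ^ 2 + (ν₀ + ν * s) ^ 2)) s := fun s => hasDerivAt_arctan_affine hμ ν₀ ν s
  have hcont : Continuous fun s : ℝ => ν * μ / (μ ^ 2 + (ν₀ + ν * s) ^ 2) :=
    continuous_const.div (by fun_prop) (fun s => by positivity)
  have hFTC : ∫ s in a..b, ν * μ / (μ ^ 2 + (ν₀ + ν * s) ^ 2) = g b - g a :=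
    intervalIntegral.integral_eq_sub_of_hasDerivAt (fun s _ => hg' s) (hcont.intervalIntegrable _ _)
  -- the integrand is `(‖C‖ |ν| /(ν μ)) · (ν μ /(μ²+…))`
  have hνμ : ν * μ ≠ 0 := mul_ne_zero hν hμ
  have hpt : ∀ s : ℝ, ‖C‖ * |ν| / (μ ^ 2 + (ν₀ + ν * s) ^ 2) = (‖C‖ * |ν| / (ν * μ)) * (ν * μ / (μ ^ 2 + (ν₀ + ν * s) ^ 2)) := by
    intro s
    have : μ ^ 2 + (ν₀ + ν * s) ^ 2 ≠ 0 := by positivity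
    field_simp
  simp_rw [hpt]
  rw [intervalIntegral.integral_const_mul, hFTC]
  -- `|g b − g a| < π`
  have hga := Real.arctan_lt_pi_div_two ((ν₀ + ν * a) / μ)
  have hga' := Real.neg_pi_div_two_lt_arctan ((ν₀ + ν * a) / μ)
  have hgb := Real.arctan_lt_pi_div_two ((ν₀ + ν * b) / μ)
  have hgb' := Real.neg_pi_div_two_lt_arctan ((ν₀ + ν * b) / μ)
  have hdiff : |g b - g a| ≤ Real.pi := by
    rw [abs_le]; constructor <;> simp only [hg] <;> linarith
  have hcoef : |‖C‖ * |ν| / (ν * μ)| = ‖C‖ / |μ| := by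
    have hν' : |ν| ≠ 0 := abs_ne_zero.2 hν
    rw [abs_div, abs_mul, abs_abs, abs_norm, abs_mul]
    field_simp
  calc ‖C‖ * |ν| / (ν * μ) * (g b - g a) ≤ |‖C‖ * |ν| / (ν * μ) * (g b - g a)| := le_abs_self _
    _ = ‖C‖ / |μ| * |g b - g a| := by rw [abs_mul, hcoef]
    _ ≤ ‖C‖ / |μ| * Real.pi := mul_le_mul_of_nonneg_left hdiff (by positivity)
    _ = ‖C‖ * Real.pi / |μ| := by ring

/-! ## §4 The detuned response of one Lorentzian forcing term -/

/-- **`‖∫_a^b e^{ils} · C/(μ + i(ν₀+νs)) ds‖ ≤ ‖C‖(2 + π)/(|μ||l|)`** for `l ≠ 0`, `μ ≠ 0`, `a ≤ b` — uniformly in the length of the interval and in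
`ν₀, ν`: one integration by parts (ad-lit L2 `LinearPhase.norm_integral_exp_mul_le`) with the height bound `‖C‖/|μ|` at both ends and the total
variation bound `‖C‖π/|μ|`. [folklore] -/
theorem norm_integral_exp_mul_lorentz_le (C : ℂ) {μ l : ℝ} (hμ : μ ≠ 0) (hl : l ≠ 0) (ν₀ ν : ℝ) {a b : ℝ} (hab : a ≤ b) :
    ‖∫ s in a..b, Complex.exp ((l * s : ℝ) * Complex.I) * (C / ((μ : ℂ) + ((ν₀ + ν * s : ℝ) : ℂ) * Complex.I))‖ ≤
      ‖C‖ * (2 + Real.pi) / (|μ| * |l|) := by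
  have h := Literature.Analysis.Fourier.LinearPhase.norm_integral_exp_mul_le hl hab
    (fun s => hasDerivAt_lorentz C hμ ν₀ ν s) (continuous_lorentz_deriv C hμ ν₀ ν)
  refine h.trans ?_
  have h1 := norm_lorentz_le C hμ ν₀ ν a
  have h2 := norm_lorentz_le C hμ ν₀ ν b
  have h3 := integral_norm_lorentz_deriv_le C hμ ν₀ ν a b
  have hX : ‖C / ((μ : ℂ) + ((ν₀ + ν * a : ℝ) : ℂ) * Complex.I)‖ + ‖C / ((μ : ℂ) + ((ν₀ + ν * b : ℝ) : ℂ) * Complex.I)‖ +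
      ∫ s in a..b, ‖-(C * ((ν : ℂ) * Complex.I)) / ((μ : ℂ) + ((ν₀ + ν * s : ℝ) : ℂ) * Complex.I) ^ 2‖ ≤ ‖C‖ * (2 + Real.pi) / |μ| := by
    have e : ‖C‖ / |μ| + ‖C‖ / |μ| + ‖C‖ * Real.pi / |μ| = ‖C‖ * (2 + Real.pi) / |μ| := by ring
    linarith
  calc _ ≤ (‖C‖ * (2 + Real.pi) / |μ|) / |l| := div_le_div_of_nonneg_right hX (abs_nonneg l)
    _ = ‖C‖ * (2 + Real.pi) / (|μ| * |l|) := by rw [div_div]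

end Summit.AnomalousDissipation.AnomalousDissipation.Theorems.SawtoothPulseCascade.K2PhaseBudget

end
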